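import Summits.QuantumFields.BalabanUV.Beta.GAN24.TaylorRowLamInner
import Summits.QuantumFields.BalabanUV.Beta.GAN24.TaylorMassLamSymAt
import Summits.QuantumFields.BalabanUV.Beta.GAN24.E3UnitSplitLevelsSymAt

/-!
# Road «S3-Taylor», Λ SHAPE rows AT THE SYM TABLE, part 1 of 3: THE INNER IDENTITY for the SYMMETRISED Lagrange increment `symLagrIncAt d (toSite r) Lc M N′`
# (sym twin of leaf-06 g40's (ρ-c) `TaylorRowLamInnerAt`, itself the rooted twin of `TaylorRowLamInner`)

NOT IN PRINT — OUR BOOKKEEPING (road-P2 = `b2b-balaban-gan24-p2` gen 56, 2026-08-25; row G-an2-4 ∕ (CONV-C), the (α-0) chain at row D1's literal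
OF RECORD (III′) `JsB12CombShSym`; [folklore] composition BY NAME; 0 `def`, 0 cite, 0 `def … : Prop`, 0 `sorry`).  Weight 0.  NEVER «G-an2-4 closed» as (CONV-C);
NOT D1, NOT BetaPertH, NOT continuum, NOT Clay; NO campaign opened (an2 W-4) — typed while idle under R-2 as the THIRD BRICK of the located `hUg-Λ` transfer
(road-P2 MEMO M-gan24p2-g56-1, `gen56/S-CAMPAIGN-SIZING-g56.v0_4.md` §2(a)).

METHOD = the OWNER gan24-p1's gen-6 `mkroot.py` rule (road-P2's `tools/mksym.py`): leaf-06's (ρ-c) part 1 VERBATIM with an1's SYM table `symHessFFAt (toSite r) Lc`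
(`r ∈ box (d+1) Lc`) in place of the rooted `hessFFAt (toSite r) Lc` and the symmetrised increment `E3UnitSplitLevelsSymAt.symLagrIncAt d (toSite r) Lc` (M.66) in place of
asym's `SpineRooted.lagrIncAt`; the table enters ONLY through (ρ-a)-sym `TaylorMassLamSymAt.avgLift_symHessFFAt_ne_zero` (M.65 — SAME radius as (ρ-a)); every ROOT-FREE lemma of
the base module is used BY NAME (not re-declared); same theorem names in the namespace `TaylorRowLamSymAt`; rooted and base modules untouched; no zero-root bridge (the sym table has
no root-0 base twin).
## Contents (generic `d`; member `N = N′·R`, level `M`, inner blocking `N′`; root `r ∈ box (d+1) Lc`)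
§2-σ the finite `Y`-range of the lifted SYM constraint Hessian (`mem_boxY_of_avgLift_ne_zero`) and **`inner_eq`** with `hessFFAt ↦ symHessFFAt`, `lagrIncAt ↦ symLagrIncAt`.
Discharges NOTHING of (hS, hSall), the K-slot or BetaPertH by itself.
-/

noncomputable section

open Finset
open scoped BigOperators
open Literature.MathematicalPhysics.QuantumFieldTheory
open Literature.MathematicalPhysics.QuantumFieldTheory.Balaban1983to89
open Literature.MathematicalPhysics.QuantumFieldTheory.Balaban1983to89.Beta
open Literature.Probability.LatticeModels (Torus.proj Torus.proj_apply)
open AffineAveraging (Site Form1 unitVec unitVec_apply box toSite)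
open AffineReproduction (contourSumAdj)
open LatticeForm (quo)
open B12Sec2to5 (l1 l1_nonneg)
open ExpKernelCalculus (MKer Zl BiLoc l1_sub_triangle l1_sub_symm l1_natSmul)
open OneStepResolventKernel (Fib KInv LocStencil proj_zsmul quo_zsmul eq_zsmul_quo_of_proj KInv_inr_inr_coarse)
open KernelSpecInstance (wH wΦ)
open KKTFluctuationKernel (GamΦ)
open InterLevelTransport (SLam avgLift cwsum cwsum_apply onLat onLat_zsmul onLat_off)
open BalabanStepJets (lamCoeffOf)
open BalabanCompositeJets (lagrInc)
open AveragingHessianKernels (hessFF ell)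
open Summit.QuantumFields.BalabanUV.Beta.GAN24.TaylorLamVertexPairing (vertexPair_eq summable_wH_mul_lamCoeffOf quo_quo
  abs_contourSumAdj_le_exp)
open Summit.QuantumFields.BalabanUV.Beta.SymAveragingHessianCounts (symHessFFAt symHessKerAt symHessFFAt_inl_inl symHessFFAt_inl_inr symHessFFAt_inr
  symHessKerAt_eq_zero_left symHessKerAt_eq_zero_right abs_symHessKerAt_le biLoc_symHessFFAt)
open Summit.QuantumFields.BalabanUV.Beta.GAN24.E3UnitSplitLevelsSymAt (symLagrIncAt)
open Summit.QuantumFields.BalabanUV.Beta.GAN24.TaylorMassLamSymAt (abs_avgLift_symHessFFAt_le avgLift_symHessFFAt_ne_zero)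
open Summit.QuantumFields.BalabanUV.Beta.GAN24.TaylorRowLam (mem_box_of_l1_le l1_le_of_mem_box card_box)
open Summit.QuantumFields.BalabanUV.Beta.GAN24.TaylorBlockSum (abs_ediv_sub_ediv_le nonneg_of_dominated)

namespace Summit.QuantumFields.BalabanUV.Beta.GAN24.TaylorRowLamSymAt

variable {d : ℕ}

/-! ## §2 The inner identity: the vertex block-average against the Lagrange increment, rewritten through the exact vertex pairing -/

section Inner

variable {Lc : ℕ} [NeZero Lc] {r : Fin (d + 1) → ℕ}

/-- [folklore] The finite `Y`-range of the lifted constraint Hessian seen from a fine point `w`: if `avgLift M (symHessFFAt (toSite r) Lc μ Y) w y ≠ 0` then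
`Y` lies in the sup-norm box of radius `4(d+1)+1` around `quo (M·Lc) w` (leaf-11's support radius `2(d+1)(Lc+1)M ≤ 4(d+1)·(M·Lc)`). -/
theorem mem_boxY_of_avgLift_ne_zero (hr : r ∈ box (d + 1) Lc) (M : ℕ) [NeZero M] {μ : Fin (d + 1)} {Y w y : Site (d + 1)} {a b : Fib d}
    (h : avgLift M (symHessFFAt (toSite r) Lc μ Y) w y a b ≠ 0) :
    Y ∈ Fintype.piFinset fun j => Finset.Icc (quo (M * Lc) w j - (4 * (d + 1) + 1 : ℕ)) (quo (M * Lc) w j + (4 * (d + 1) + 1 : ℕ)) := by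
  have hw := (avgLift_symHessFFAt_ne_zero M (Nat.one_le_iff_ne_zero.2 (NeZero.ne Lc)) hr h).1
  have hML : 0 < M * Lc := Nat.mul_pos (Nat.pos_of_ne_zero (NeZero.ne M)) (Nat.pos_of_ne_zero (NeZero.ne Lc))
  haveI : NeZero (M * Lc) := ⟨hML.ne'⟩
  rw [Fintype.mem_piFinset]
  intro j
  rw [Finset.mem_Icc]
  -- coordinate `j`: `|w j − (M Lc) Y j| ≤ 2(d+1)(Lc+1)M`, hence `|quo (M Lc) w j − Y j| ≤ 2(d+1)(Lc+1)M/(M Lc) + 1 ≤ 4(d+1) + 1`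
  have hc : |(((w - ((M * Lc : ℕ) : ℤ) • Y) j : ℤ) : ℝ)| ≤ 2 * ((d : ℝ) + 1) * (Lc + 1) * M :=
    (Finset.single_le_sum (f := fun μ => |(((w - ((M * Lc : ℕ) : ℤ) • Y) μ : ℤ) : ℝ)|) (fun μ _ => abs_nonneg _)
      (Finset.mem_univ j)).trans hw
  have hq := abs_ediv_sub_ediv_le hML (w j) (((M * Lc : ℕ) : ℤ) * Y j)
  have hY : ((M * Lc : ℕ) : ℤ) * Y j / ((M * Lc : ℕ) : ℤ) = Y j := by
    rw [mul_comm]; exact Int.mul_ediv_cancel _ (by exact_mod_cast hML.ne')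
  rw [hY] at hq
  have hc' : |(((w j - ((M * Lc : ℕ) : ℤ) * Y j : ℤ)) : ℝ)| ≤ 2 * ((d : ℝ) + 1) * (Lc + 1) * M := by
    simpa only [Pi.sub_apply, Pi.smul_apply, smul_eq_mul] using hc
  have hML' : (0 : ℝ) < ((M * Lc : ℕ) : ℝ) := by exact_mod_cast hML
  have hratio : 2 * ((d : ℝ) + 1) * (Lc + 1) * M / ((M * Lc : ℕ) : ℝ) ≤ 4 * ((d : ℝ) + 1) := by
    have hM : (0 : ℝ) < M := by exact_mod_cast Nat.pos_of_ne_zero (NeZero.ne M)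
    have hL : (1 : ℝ) ≤ Lc := by exact_mod_cast (Nat.one_le_iff_ne_zero.2 (NeZero.ne Lc))
    rw [div_le_iff₀ hML']
    have e : ((M * Lc : ℕ) : ℝ) = (M : ℝ) * Lc := by push_cast; ring
    rw [e]
    nlinarith [mul_nonneg (show (0 : ℝ) ≤ 2 * ((d : ℝ) + 1) * M by positivity) (show (0 : ℝ) ≤ (Lc : ℝ) - 1 by linarith)]
  have hfin : (((|w j / ((M * Lc : ℕ) : ℤ) - Y j| : ℤ)) : ℝ) ≤ 4 * ((d : ℝ) + 1) + 1 := by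
    refine hq.trans ?_
    have := div_le_div_of_nonneg_right hc' hML'.le
    linarith
  have hfin' : |w j / ((M * Lc : ℕ) : ℤ) - Y j| ≤ ((4 * (d + 1) + 1 : ℕ) : ℤ) := by
    have e : (((4 * (d + 1) + 1 : ℕ) : ℤ) : ℝ) = 4 * ((d : ℝ) + 1) + 1 := by push_cast; ring
    exact_mod_cast (hfin.trans_eq e.symm)
  rw [abs_le] at hfin'
  simp only [quo]
  constructor <;> omega

/-- [folklore] **THE INNER IDENTITY.**  Inside the Λ unit sandwich of `E3UnitSplitLevels.e3Lam_unit_split` (member `N = N′·R`, level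
`M`, inner blocking `N′ = M·Lc`), the vertex block-average against the Lagrange increment equals a one-channel vertex average whose vertex leg
is the on-lattice extension of `N^{d+2}·𝒬ᵀ_R Φ̃_N^{(κ′,u′)}` and whose table is the on-lattice family of lifted constraint Hessians:
`Σ_{κ″} N^{−(d+1)} Σ'_u H̃_N(κ″; u − N•u′)·lagrInc(κ″,u)(w,y;l,l′) = Σ_μ N^{−(d+1)} Σ'_v onLat N′ (N^{d+2}·𝒬ᵀ_R φ μ) v · onLat N′ (avgLift M (symHessFFAt (toSite r) Lc μ ·)) v w y l l′`. -/
theorem inner_eq (hr : r ∈ box (d + 1) Lc) {N N' M R : ℕ} [NeZero N] [NeZero N'] [NeZero M] (hN : N = N' * R)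
    (κ' : Fin (d + 1)) (u' w y : Site (d + 1)) (l l' : Fin (d + 1)) :
    ∑ κ'' : Fin (d + 1), ((N : ℝ) ^ (d + 1))⁻¹ * ∑' u : Site (d + 1),
        ((N : ℝ) ^ (d + 2) * wH (N := N) κ'' κ' (u - (N : ℤ) • u')) * symLagrIncAt d (toSite r) Lc M N' κ'' u w y (Sum.inl l) (Sum.inl l') =
      ∑ μ : Fin (d + 1), ((N : ℝ) ^ (d + 1))⁻¹ * ∑' v : Site (d + 1),
        onLat N' (fun Y => (N : ℝ) ^ (d + 2) * contourSumAdj R (fun κ q => wΦ (N := N) κ κ' (q - u')) μ Y) v *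
          onLat N' (fun Y => avgLift M (symHessFFAt (toSite r) Lc μ Y)) v w y (Sum.inl l) (Sum.inl l') := by
  -- the finite `Y`-range seen from `w`
  set SY : Finset (Site (d + 1)) :=
    Fintype.piFinset fun j => Finset.Icc (quo (M * Lc) w j - (4 * (d + 1) + 1 : ℕ)) (quo (M * Lc) w j + (4 * (d + 1) + 1 : ℕ)) with hSY
  have hsupp : ∀ μ Y, Y ∉ SY → avgLift M (symHessFFAt (toSite r) Lc μ Y) w y (Sum.inl l) (Sum.inl l') = 0 := by
    intro μ Y hY
    by_contra h
    exact hY (mem_boxY_of_avgLift_ne_zero hr M h)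
  -- abbreviations
  set c : ℝ := ((N : ℝ) ^ (d + 1))⁻¹ with hc
  set h : Fin (d + 1) → Site (d + 1) → ℝ := fun κ'' u => (N : ℝ) ^ (d + 2) * wH (N := N) κ'' κ' (u - (N : ℤ) • u') with hh
  set lam : Fin (d + 1) → Site (d + 1) → Fin (d + 1) → Site (d + 1) → ℝ :=
    fun μ Y κ'' u => lamCoeffOf (KInv (N := N') (d := d)) N' μ Y κ'' u with hlam
  set aL : Fin (d + 1) → Site (d + 1) → ℝ := fun μ Y => avgLift M (symHessFFAt (toSite r) Lc μ Y) w y (Sum.inl l) (Sum.inl l') with haL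
  set ψ : Fin (d + 1) → Site (d + 1) → ℝ :=
    fun μ Y => (N : ℝ) ^ (d + 2) * contourSumAdj R (fun κ q => wΦ (N := N) κ κ' (q - u')) μ Y with hψ
  -- (1) the increment at field legs, as a finite `Y`-sum
  have hinc : ∀ κ'' u, symLagrIncAt d (toSite r) Lc M N' κ'' u w y (Sum.inl l) (Sum.inl l') = -∑ μ, ∑ Y ∈ SY, lam μ Y κ'' u * aL μ Y := by
    intro κ'' u
    change SLam N' (lamCoeffOf (KInv (N := N') (d := d)) N') (fun μ Y => avgLift M (symHessFFAt (toSite r) Lc μ Y)) κ'' u w y (Sum.inl l) (Sum.inl l')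
      = _
    simp only [SLam]
    congr 1
    refine Finset.sum_congr rfl fun μ _ => ?_
    rw [cwsum_apply]
    exact tsum_eq_sum fun Y hY => by simp only [hsupp μ Y hY, mul_zero]
  -- (2) summability of each `u`-term
  have hsum : ∀ κ'' μ Y, Summable fun u => h κ'' u * (lam μ Y κ'' u * aL μ Y) := by
    intro κ'' μ Y
    have hs := (summable_wH_mul_lamCoeffOf (N := N) (N' := N') κ' μ κ'' u' Y).mul_left ((N : ℝ) ^ (d + 2) * aL μ Y)
    refine hs.congr fun u => ?_
    simp only [hh, hlam]; ring
  -- (3) the exact pairing, per `(μ, Y)`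
  have hpair : ∀ μ Y, ∑ κ'', ∑' u, h κ'' u * lam μ Y κ'' u = -ψ μ Y := by
    intro μ Y
    have hv := vertexPair_eq (d := d) (N := N) (N' := N') (R := R) hN κ' μ u' Y
    calc ∑ κ'', ∑' u, h κ'' u * lam μ Y κ'' u
        = ∑ κ'', (N : ℝ) ^ (d + 2) * ∑' u, wH (N := N) κ'' κ' (u - (N : ℤ) • u') * lamCoeffOf (KInv (N := N') (d := d)) N' μ Y κ'' u := by
          refine Finset.sum_congr rfl fun κ'' _ => ?_
          rw [← tsum_mul_left]
          exact tsum_congr fun u => by simp only [hh, hlam]; ring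
      _ = _ := by rw [← Finset.mul_sum, hv, hψ]; ring
  -- (4) step by step
  have s1 : ∀ κ'', ∑' u, h κ'' u * symLagrIncAt d (toSite r) Lc M N' κ'' u w y (Sum.inl l) (Sum.inl l')
      = ∑ μ, ∑ Y ∈ SY, ∑' u, -(h κ'' u * (lam μ Y κ'' u * aL μ Y)) := by
    intro κ''
    calc ∑' u, h κ'' u * symLagrIncAt d (toSite r) Lc M N' κ'' u w y (Sum.inl l) (Sum.inl l')
        = ∑' u, ∑ μ, ∑ Y ∈ SY, -(h κ'' u * (lam μ Y κ'' u * aL μ Y)) := by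
          refine tsum_congr fun u => ?_
          rw [hinc, mul_neg, Finset.mul_sum, ← Finset.sum_neg_distrib]
          refine Finset.sum_congr rfl fun μ _ => ?_
          rw [Finset.mul_sum, ← Finset.sum_neg_distrib]
      _ = ∑ μ, ∑ Y ∈ SY, ∑' u, -(h κ'' u * (lam μ Y κ'' u * aL μ Y)) := by
          rw [Summable.tsum_finsetSum (fun μ _ => summable_sum fun Y _ => (hsum κ'' μ Y).neg)]
          exact Finset.sum_congr rfl fun μ _ => Summable.tsum_finsetSum (fun Y _ => (hsum κ'' μ Y).neg)
  have s2 : ∀ μ Y, ∑ κ'', c * ∑' u, -(h κ'' u * (lam μ Y κ'' u * aL μ Y)) = c * (ψ μ Y * aL μ Y) := by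
    intro μ Y
    have e : ∀ κ'', ∑' u, -(h κ'' u * (lam μ Y κ'' u * aL μ Y)) = -((∑' u, h κ'' u * lam μ Y κ'' u) * aL μ Y) := by
      intro κ''
      rw [tsum_neg, ← tsum_mul_right]
      exact congrArg Neg.neg (tsum_congr fun u => by ring)
    simp_rw [e]
    rw [← Finset.mul_sum,
      show (∑ κ'', -((∑' u, h κ'' u * lam μ Y κ'' u) * aL μ Y)) = -((∑ κ'', ∑' u, h κ'' u * lam μ Y κ'' u) * aL μ Y) by
        rw [Finset.sum_mul, Finset.sum_neg_distrib], hpair]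
    ring
  calc ∑ κ'', c * ∑' u, h κ'' u * symLagrIncAt d (toSite r) Lc M N' κ'' u w y (Sum.inl l) (Sum.inl l')
      = ∑ κ'', ∑ μ, ∑ Y ∈ SY, c * ∑' u, -(h κ'' u * (lam μ Y κ'' u * aL μ Y)) := by
        refine Finset.sum_congr rfl fun κ'' _ => ?_
        rw [s1, Finset.mul_sum]
        exact Finset.sum_congr rfl fun μ _ => Finset.mul_sum _ _ _
    _ = ∑ μ, ∑ Y ∈ SY, ∑ κ'', c * ∑' u, -(h κ'' u * (lam μ Y κ'' u * aL μ Y)) := by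
        rw [Finset.sum_comm]
        exact Finset.sum_congr rfl fun μ _ => Finset.sum_comm
    _ = ∑ μ, ∑ Y ∈ SY, c * (ψ μ Y * aL μ Y) := by
        refine Finset.sum_congr rfl fun μ _ => Finset.sum_congr rfl fun Y _ => s2 μ Y
    _ = ∑ μ, c * ∑ Y ∈ SY, ψ μ Y * aL μ Y := by
        refine Finset.sum_congr rfl fun μ _ => ?_
        rw [Finset.mul_sum]
    _ = _ := by
        refine Finset.sum_congr rfl fun μ _ => ?_
        congr 1
        have hcw := cwsum_apply (N := N') (fun Y => ψ μ Y) (fun Y => avgLift M (symHessFFAt (toSite r) Lc μ Y)) w y (Sum.inl l) (Sum.inl l')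
        unfold InterLevelTransport.cwsum OneStepResolventKernel.wsum at hcw
        rw [hψ] at hcw
        rw [hcw]
        symm
        exact tsum_eq_sum fun Y hY => by simp only [hsupp μ Y hY, mul_zero]

end Inner

end Summit.QuantumFields.BalabanUV.Beta.GAN24.TaylorRowLamSymAt

end
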